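import Summits.ValiantsHypothesis.ValiantsHypothesis.Theorems.MonotoneRestorationOrbitRestorationQPValueOrbitWide
import Summits.ValiantsHypothesis.ValiantsHypothesis.Theorems.MonotoneRestorationOrbitRestorationQPValueOrbitIff
import HarnessLib

/-!
# `OrbitRestorationQP` ⟺ quasi-polynomial ORBIT WIDTH of wide derivations (ORBIT currency, XII)

Route MonotoneRestoration, crux `OrbitRestorationQP` (stmt-ValiantsHypothesis-18293), namespaces
`Summit.ValiantsHypothesis.ValiantsHypothesis.Theorems.WideConverse` / `…ValueOrbit`.

The converse of wide value-orbit symmetrisation (`…ValueOrbitWide.lean`) holds VERBATIM — no Newton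
identities: the gate values of a `Γ`-symmetric circuit `C`, each derived by its gate's own step (sum / product
of the children values, of any fan-in), form a wide derivation of orbit width `≤ ORB(C)`, because gate values
and children multisets move with the gates.  Hence the cleanest form of the crux:

  `OrbitRestorationQP` ⟺ every matrix-symmetric `VP` family has, for one `c` and every `n`, SOME computation
  (sums and products of any fan-in, any length) in which every intermediate value and every product gate's
  operand multiset has `Sym(Fin n)`-orbit `≤ 2^((log₂ n + c)^c)` (`orbitRestorationQP_iff_wideOrbitQP`).

* `WideConverse.toWide`, `toWide_width`, `exists_wide_of_symmetric`;
* `ValueOrbit.qpOrbit_of_wide`, `ValueOrbit.orbitRestorationQP_iff_wideOrbitQP`.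

Everything is proved; the crux (VH-strength) is not claimed. [folklore]
-/

noncomputable section

open scoped Classical

-- `Summit.ValiantsHypothesis.ValiantsHypothesis.…` is the tree's single-conjunct layout (Sub = Summit).
set_option linter.dupNamespace false

namespace Summit.ValiantsHypothesis.ValiantsHypothesis.Theorems

universe u v w

namespace WideConverse

open Literature.Computability.AlgebraicComplexity LabelledArithCircuit Finset SymmetricValues

variable {K : Type u} {X : Type v} {G : Type w} [Field K] (C : LabelledArithCircuit K X Unit G)
variable {Γ : Type*} [Group Γ] [MulAction Γ X]

/-- **Children multisets move with the gates**: a gate function into multisets transported by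
automorphisms has orbits inside gate orbits. [folklore] -/
theorem ncard_range_multiset_le_orbitSize [Fintype G] (hC : C.IsSymmetric Γ)
    (Φ : G → Multiset (MvPolynomial X K))
    (hΦ : ∀ (γ : Γ) (π : Equiv.Perm G), C.IsAutomorphismExtending γ π → ∀ g, (Φ g).map (ren γ) = Φ (π g))
    (g : G) : (Set.range fun γ : Γ => (Φ g).map (ren γ)).ncard ≤ C.orbitSize Γ := by
  have hsub : (Set.range fun γ : Γ => (Φ g).map (ren γ)) ⊆ Φ '' C.autOrbit Γ g := by
    rintro _ ⟨γ, rfl⟩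
    obtain ⟨π, hπ⟩ := hC γ
    exact ⟨π g, ⟨γ, π, hπ, rfl⟩, (hΦ γ π hπ g).symm⟩
  exact (Set.ncard_le_ncard hsub ((Set.toFinite _).image Φ)).trans
    ((Set.ncard_image_le (Set.toFinite _)).trans (C.ncard_autOrbit_le_orbitSize Γ g))

/-- The children-values multiset transports. [folklore] -/
theorem map_ren_childrenValues {γ : Γ} {π : Equiv.Perm G} (hπ : C.IsAutomorphismExtending γ π) (g : G) :
    ((C.children g).val.map C.eval).map (ren γ) = (C.children (π g)).val.map C.eval := by
  rw [hπ.children_apply g, Finset.map_val, Multiset.map_map, Multiset.map_map]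
  exact Multiset.map_congr rfl fun h _ => ren_eval hπ h

/-- The wide step of a gate: its own operation on its children values. [folklore] -/
def gateStep (g : G) : WStep K X :=
  match C.label g with
  | .var x => WStep.var x
  | .const c => WStep.const c
  | .add => WStep.sum ((C.children g).val.map fun h => (1, C.eval h))
  | .mul => WStep.prod ((C.children g).val.map C.eval)

/-- The gate step computes the gate value. [folklore] -/
theorem gateStep_value (g : G) : (gateStep C g).value = C.eval g := by
  rcases hl : C.label g with x | c | _ | _ <;> simp only [gateStep, hl]
  · exact (C.eval_of_label_var hl).symm
  · exact (C.eval_of_label_const hl).symm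
  · simp only [WStep.value, Multiset.map_map, Function.comp_def, map_one, one_mul]
    rw [C.eval_of_label_add hl, Finset.sum_eq_multiset_sum]
  · simp only [WStep.value]
    rw [C.eval_of_label_mul hl, Finset.prod_eq_multiset_prod]

/-- The operands of the gate step are children values. [folklore] -/
theorem gateStep_args (g : G) {u : MvPolynomial X K} (hu : u ∈ (gateStep C g).args) :
    ∃ h ∈ C.children g, C.eval h = u := by
  rcases hl : C.label g with x | c | _ | _ <;> simp only [gateStep, hl, WStep.args] at hu
  · simp at hu
  · simp at hu
  · simp only [Multiset.map_map, Function.comp_def, Multiset.mem_map, Finset.mem_val] at hu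
    exact hu
  · simp only [Multiset.mem_map, Finset.mem_val] at hu
    exact hu

/-- A product gate step is the product of the children values. [folklore] -/
theorem gateStep_eq_prod {g : G} {M : Multiset (MvPolynomial X K)} (h : gateStep C g = WStep.prod M) :
    M = (C.children g).val.map C.eval := by
  rcases hl : C.label g with x | c | _ | _ <;> simp only [gateStep, hl] at h
  · cases h
  · cases h
  · cases h
  · exact (WStep.prod.inj h).symm

variable [Fintype G]

/-- The rank of a value: the least height of a gate computing it. [folklore] -/
def wrank (q : MvPolynomial X K) : ℕ := sInf {r : ℕ | ∃ g : G, C.eval g = q ∧ ht C g = r}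

/-- **The wide derivation of a circuit**: the gate values, each derived by a least-height gate's own step.
[folklore] -/
def toWide : WideDerivation K X where
  S := univ.image C.eval
  rank := wrank C
  step := by
    intro q hq
    obtain ⟨g, -, hg⟩ := mem_image.1 hq
    have hne : {r : ℕ | ∃ g : G, C.eval g = q ∧ ht C g = r}.Nonempty := ⟨_, g, hg, rfl⟩
    obtain ⟨g₀, hg₀, hr⟩ := Nat.sInf_mem hne
    refine ⟨gateStep C g₀, ⟨by rw [gateStep_value, hg₀], fun u hu => ?_⟩⟩
    obtain ⟨h, hh, rfl⟩ := gateStep_args C g₀ hu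
    refine ⟨mem_image.2 ⟨h, mem_univ h, rfl⟩, ?_⟩
    calc wrank C (C.eval h) ≤ ht C h := Nat.sInf_le ⟨h, rfl, rfl⟩
      _ < ht C g₀ := ht_lt_of_mem C hh
      _ = wrank C q := hr

/-- The output value is a value of the wide derivation. [folklore] -/
theorem output_mem_toWide : C.eval (C.output ()) ∈ (toWide C).S :=
  mem_image.2 ⟨C.output (), mem_univ _, rfl⟩

/-- **The wide derivation of a `Γ`-symmetric circuit has orbit width `≤ ORB(C)`** — values and children
multisets move with the gates; no Newton identities needed. [folklore] -/
theorem toWide_width {Γ : Type} [Group Γ] [Fintype Γ] [MulAction Γ X] (hC : C.IsSymmetric Γ) :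
    (toWide C).OrbitWidthLE Γ (C.orbitSize Γ) := by
  intro q hq
  obtain ⟨g, -, hg⟩ := mem_image.1 hq
  refine ⟨?_, ?_⟩
  · rw [← hg]
    exact ncard_range_le_orbitSize C hC (fun g => C.eval g) (fun γ π hπ g => ren_eval hπ g) g
  · have hne : {r : ℕ | ∃ g : G, C.eval g = q ∧ ht C g = r}.Nonempty := ⟨_, g, hg, rfl⟩
    obtain ⟨g₀, hg₀, hr⟩ := Nat.sInf_mem hne
    refine ⟨gateStep C g₀, ⟨by rw [gateStep_value, hg₀], fun u hu => ?_⟩, fun M hM => ?_⟩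
    · obtain ⟨h, hh, rfl⟩ := gateStep_args C g₀ hu
      refine ⟨mem_image.2 ⟨h, mem_univ h, rfl⟩, ?_⟩
      calc wrank C (C.eval h) ≤ ht C h := Nat.sInf_le ⟨h, rfl, rfl⟩
        _ < ht C g₀ := ht_lt_of_mem C hh
        _ = wrank C q := hr
    · rw [gateStep_eq_prod C hM]
      exact ncard_range_multiset_le_orbitSize C hC (fun g => (C.children g).val.map C.eval)
        (fun γ π hπ g => map_ren_childrenValues C hπ g) g₀

/-- **CONVERSE OF WIDE VALUE-ORBIT SYMMETRISATION**: a `Γ`-symmetric circuit computing `f` yields a wide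
derivation of `f` of orbit width `≤ ORB(C)`. [folklore] -/
theorem exists_wide_of_symmetric {Γ : Type} [Group Γ] [Fintype Γ] [MulAction Γ X] (hC : C.IsSymmetric Γ) :
    ∃ 𝒲 : WideDerivation K X, C.eval (C.output ()) ∈ 𝒲.S ∧ 𝒲.OrbitWidthLE Γ (C.orbitSize Γ) :=
  ⟨toWide C, output_mem_toWide C, toWide_width C hC⟩

end WideConverse

namespace ValueOrbit

open Literature.Computability.AlgebraicComplexity

/-- Orbit width is monotone in the bound. [folklore] -/
theorem orbitWidthLE_mono {n : ℕ} {𝒲 : WideDerivation ℂ (Fin n × Fin n)} {B B' : ℕ} (hBB : B ≤ B')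
    (h : 𝒲.OrbitWidthLE (Equiv.Perm (Fin n)) B) : 𝒲.OrbitWidthLE (Equiv.Perm (Fin n)) B' := by
  intro q hq
  obtain ⟨h1, d, hd, hM⟩ := h q hq
  exact ⟨h1.trans hBB, d, hd, fun M hdM => (hM M hdM).trans hBB⟩

/-- **Quasi-polynomial orbit WIDTH gives quasi-polynomial symmetric orbit size.** [folklore] -/
theorem qpOrbit_of_wide {n c : ℕ} (𝒲 : WideDerivation ℂ (Fin n × Fin n))
    {f : MvPolynomial (Fin n × Fin n) ℂ} (hf : f ∈ 𝒲.S) (hfix : ∀ σ : Equiv.Perm (Fin n), ren σ f = f)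
    (hW : 𝒲.OrbitWidthLE (Equiv.Perm (Fin n)) (2 ^ ((Nat.log 2 n + c) ^ c))) :
    ∃ (G : Type) (_ : Fintype G) (C : LabelledArithCircuit ℂ (Fin n × Fin n) Unit G),
      C.IsSymmetric (Equiv.Perm (Fin n)) ∧ C.eval (C.output ()) = f ∧
        C.orbitSize (Equiv.Perm (Fin n)) ≤ 2 ^ ((Nat.log 2 n + (c + 3)) ^ (c + 3)) := by
  set L := Nat.log 2 n with hL
  set B := 2 ^ ((L + c) ^ c + 2 * L + 2) with hB
  have hB1 : 1 ≤ B := Nat.one_le_two_pow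
  have hX : ∀ x : Fin n × Fin n, (Set.range fun σ : Equiv.Perm (Fin n) => σ • x).ncard ≤ B := fun x =>
    (ncard_orbit_var_le n x).trans ((sq_le_pow_log n).trans (Nat.pow_le_pow_right (by norm_num) (by omega)))
  have hW' : 𝒲.OrbitWidthLE (Equiv.Perm (Fin n)) B :=
    orbitWidthLE_mono (Nat.pow_le_pow_right (by norm_num) (by omega)) hW
  obtain ⟨G, inst, C, hC, hev, horb⟩ := WideDerivation.exists_symmetric_of_wide 𝒲 hW' hf hB1 hfix hX
  refine ⟨G, inst, C, hC, hev, horb.trans ?_⟩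
  rw [hB, ← pow_add, ← two_mul]
  exact Nat.pow_le_pow_right (by norm_num) (exp_arith L c)

/-- **`OrbitRestorationQP` ⟺ QUASI-POLYNOMIAL ORBIT WIDTH.**  The crux holds iff every matrix-symmetric `VP`
family over `ℂ` has, for one constant `c` and every `n`, SOME wide derivation of `f n` — an ordinary
computation with sums and products of any fan-in, of any length — in which every value and every product
step's operand multiset has `Sym(Fin n)`-orbit (diagonal action) `≤ 2^((log₂ n + c)^c)`.  (`⇐`: wide
value-orbit symmetrisation; `⇒`: the gate values of the symmetric circuits themselves.) Neither side is
claimed. [folklore] -/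
theorem orbitRestorationQP_iff_wideOrbitQP :
    Theses.MonotoneRestoration.OrbitRestorationQP ↔
    ∀ f : (n : ℕ) → MvPolynomial (Fin n × Fin n) ℂ,
      (∀ (n : ℕ) (σ τ : Equiv.Perm (Fin n)),
        MvPolynomial.rename (fun p : Fin n × Fin n => (σ p.1, τ p.2)) (f n) = f n) →
      IsVPFamily f →
      ∃ c : ℕ, ∀ n : ℕ, ∃ 𝒲 : WideDerivation ℂ (Fin n × Fin n), f n ∈ 𝒲.S ∧
        𝒲.OrbitWidthLE (Equiv.Perm (Fin n)) (2 ^ ((Nat.log 2 n + c) ^ c)) := by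
  constructor
  · intro h f hsymm hVP
    obtain ⟨c, hc⟩ := h f hsymm hVP
    refine ⟨c, fun n => ?_⟩
    obtain ⟨G, inst, C, hC, hev, horb⟩ := hc n
    obtain ⟨𝒲, hf, hW⟩ := WideConverse.exists_wide_of_symmetric C hC
    exact ⟨𝒲, hev ▸ hf, orbitWidthLE_mono horb hW⟩
  · intro h f hsymm hVP
    obtain ⟨c, hc⟩ := h f hsymm hVP
    refine ⟨c + 3, fun n => ?_⟩
    obtain ⟨𝒲, hf, hW⟩ := hc n
    exact qpOrbit_of_wide 𝒲 hf (ren_eq_of_matrixSymmetric (hsymm n)) hW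

end ValueOrbit

end Summit.ValiantsHypothesis.ValiantsHypothesis.Theorems

end
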